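import Literature.MathematicalPhysics.QuantumLattice.LTQO
import Literature.MathematicalPhysics.QuantumLattice.SpinSystemProofs
import HarnessLib

/-!
# The Walker–Wang Hamiltonian of a premodular datum on the point-split cubic torus

Notion `walkerWangHamiltonian` (route `QuantumFields/YangMills/ModularSelfDualFold`, items
`ModularSelfDuality`, `NoSelfDualMasslessBand`): the 3+1D string-net model of Walker–Wang (2011)
§4.1.2 for a unitary braided (pre)modular fusion category given by its numerical data
`WalkerWang.InputData q` (unit label, fusion multiplicities `N`, quantum dimensions `d`, `F`- and
`R`-symbols, `S`-matrix) on the labels `Fin q`, on the cubic torus `(ℤ/Lℤ)³` with POINT-SPLIT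
vertices, in the tree's spin-system vocabulary: sites `WalkerWang.Edge L = TorusSite 3 L × Fin 6`,
local dimension `q` (one label per edge), all terms entries of an `Interaction (Edge L) q`, so that
`localHamiltonian`, `HasLTQO`, `HasLocalGap`, `Matrix.HasClusterGap`, `Matrix.gibbsWeight` apply
verbatim (`d = 3`, `κ = Fin 6`).

## The resolved lattice (WW §4.1.2, resolution figure; read off the TikZ of arXiv:1104.2632v2)

Each 6-valent vertex `n` is split into FOUR trivalent vertices with a `ℤ₃`-symmetry: a centre `V2`
joined by internal edges `I1 = V1V2`, `I3 = V2V3`, `I4 = V2V4` to `V1, V3, V4`, which carry the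
lattice legs in the pairs `V1 : {+x, -y}`, `V3 : {+y, -z}`, `V4 : {+z, -x}`. Edge slots (`Fin 6`):
`0, 1, 2` = the lattice edges from `n` to `n + x̂, ŷ, ẑ`; `3 = I1`, `4 = I3`, `5 = I4` at `n`
(`vertexEdge n k`, `k : Fin 4`). A square plaquette becomes a DECAGON (`4` lattice + `6` internal
edges, `boundaryEdge μ n : Fin 10 → Edge L` in the cyclic order `a p q b c r u d v w` of WW's
labelled figure; base corner `n`; `μ = 0, 1, 2` for the `xy, yz, zx` planes) with `10` legs
(`legEdge μ n i` = the third edge at the vertex between boundary edges `i` and `i + 1`; WW's primed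
labels); `decagonVertex_eq_vertexRel` checks the tables against the resolution by `decide`. The
`yz, zx` data are the images of the `xy` data under the rotation `x → y → z → x` about the viewing
axis `(1,1,1)` (`rotRel`, a lattice automorphism preserving the projection), as WW prescribe
("we need only to write down one plaquette term").

## The terms (`H = J Σ_v (1 - A_v) - lamB Σ_p Σ_s wM(s) B_p^s - lamE Σ_e h_e`)

* `vertexProj` = `A_v`: diagonal, `1` iff the three labels at `v` are admissible (`N a b c ≠ 0`)
  (WW §4.1.2); energetic form `vertexTerms (s(v)) = 1 - A_v`, hard-constraint form
  `stringNetSubspace = ⋂_v ker (1 - A_v)` with the diagonal projection `stringNetProj = ∏_v A_v`.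
* `plaquetteOp μ n s` = `B_p^s`, with the matrix elements PRINTED in WW §4.1.2 (display after "we
  claim"): `⟨ℓ''| B^s |ℓ⟩ = R^{q'b}_q conj(R^{c'r}_c) conj(R^{q'b''}_{q''}) R^{c'r''}_{c''}
  ∏_{i} F^{ℓ''ᵢ s ℓᵢ₊₁}_{ℓ'ᵢ; ℓᵢ ℓ''ᵢ₊₁}` (`plaquetteCoeff`); the `R`-pairs sit at the vertices
  `i = 2` (leg `q'` = the `+z` leg of the corner `n + x̂ + ŷ`, under-crossing) and `i = 4` (leg
  `c'` = the `-z` leg of `n`, over-crossing) of the fixed projection; labels off the decagon are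
  unchanged. `magnetic wM (region p) = -Σ_s wM s • B_p^s` (WW: `wM = d/D²`, `InputData.wwWeight`).
* `electricOp wE e` = the Verlinde field `h_e`, diagonal, `h_e |a⟩ = (Σ_s wE s S_{sa}/S_{0a}) |a⟩`
  (BvKS §V eq. (hSU2) is `wE = δ_m`); `electric wE {e} = -h_e`.
* `interaction C L J wM wE lamB lamE = J • vertexTerms + lamB • magnetic wM + lamE • electric wE`;
  `walkerWangHamiltonian = localHamiltonian (interaction …) univ`; the Euclidean transfer matrix
  `walkerWangTransfer = e^{-H_M/2} e^{-H_E} e^{-H_M/2}` (`H_M` = vertex + magnetic part,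
  `H_E` = electric part).

API proved: supports of `B_p^s`, `A_v`, `h_e`; `A_v`, `stringNetProj` are Hermitian idempotents;
`h_e`, `A_v`, `stringNetProj` are simultaneously diagonal, hence commute;
`mem_stringNetSubspace_iff`, `range_stringNetProj`;
`h_e` is Hermitian when its eigenvalues are real; `rotRel` has order `3`.

## What is NOT here

No coherence axiom (pentagon, hexagon, unitarity / tetrahedral symmetry of `F`, `|R| = 1`, unitarity
or non-degeneracy of `S`, Verlinde) is a field of `InputData`: they belong to the notion
`ModularDatum` (item `defn-ModularDatum`, `Literature/RepresentationTheory`), any instance of which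
gives an `InputData (Fintype.card labels)` by transport along `Fintype.equivFin`. Hence NOT proved
here (theorems about the datum, for provers): `[B_p, A_v] = 0`, Hermiticity of `Σ_s wM s B_p^s`,
that at `lamE = 0` the `𝒫_p = Σ_s (d_s/D²) B_p^s` are commuting projectors on the string-net
subspace (WW §4.1; vKBS §VI.A) making the model frustration-free with `HasLTQO`/`HasLocalGap`, the
unique ground state on `T³` for modular input (vKBS §VI.C), Dittrich's `S`-transform to the
dual-1-skeleton basis (the content of `ModularSelfDuality`, STATED with `walkerWangHamiltonian` at
swapped arguments `(wM, wE, lamB, lamE) ↔ (wE, wM, lamE, lamB)` compressed by `stringNetProj`), and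
the packaging of `walkerWangTransfer` into a normalised `TransferData`. Like WW we assume
multiplicity-free fusion and SELF-DUAL labels (unoriented edges; true for `SU(2)_k`, not for the
`ℤ_p`, `p ≥ 3`, models of BvKS §III). For `L ≤ 2` the `20` edges of a plaquette region need not be
distinct: the operators are defined but junk.

## Sources

K. Walker, Z. Wang, Front. Phys. 7 (2012) 150, arXiv:1104.2632v2, §4.1.1–4.1.2 [WalkerWang2011];
C. W. von Keyserlingk, F. J. Burnell, S. H. Simon, PRB 87 (2013) 045107, §III, §VI.A
[VonkeyserlingkBurnellSimon2013]; F. J. Burnell, C. W. von Keyserlingk, S. H. Simon, PRB 88 (2013)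
235120, §III.A eq. (HWW), §V eq. (hSU2) [BurnellVonkeyserlingkSimon2013]; M. Levin, X.-G. Wen,
PRB 71 (2005) 045110 [LevinWen2005]; B. Dittrich, JHEP 05 (2017) 123, arXiv:1701.02037.
Tree/Mathlib search: `Op`, `onSite`, `localOp`, `IsSupportedOn`, `Interaction`, `localHamiltonian`,
`TorusSite`, `Matrix.gibbsWeight`, `isSupportedOn_onSite_holds` reused; `lean search
'stringNet|WalkerWang|Verlinde|FSymbol|ModularDatum'` finds nothing (the AQFT `ModularData` is
Tomita–Takesaki, unrelated); Mathlib: `Matrix.diagonal`, `Matrix.of`, `Nat.iterate`.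
-/

noncomputable section

namespace Literature.MathematicalPhysics.QuantumLattice

open Matrix Finset Literature.Probability.LatticeModels

namespace WalkerWang

/-! ### Input data -/

/-- The numerical presentation of a (multiplicity-free, self-dual) unitary braided fusion category
with `q` labels `Fin q`, as consumed by the Walker–Wang Hamiltonian — Walker–Wang (2011) §4.1.1
("a particular convenient way to present a UBFC is through … `{F^{abc}_{d;nm}}` … and `{R^{ab}_c}`")
— together with its quantum dimensions and modular `S`-matrix (for the weights `d_s/D²` and the
Verlinde field of BvKS §V). Fields: `unit` = the trivial label `0`; `N a b c = N_{ab}^c` (a vertex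
with labels `a, b, c` is admissible iff `N a b c ≠ 0`; symmetric for self-dual labels);
`qdim s = d_s`; `F a b c d n m = F^{abc}_{d;nm}`, the change of basis
`((ab)_m c)_d = Σ_n F^{abc}_{d;nm} (a (bc)_n)_d` of WW §4.1.1; `R a b c = R^{ab}_c` (braiding
eigenvalue); `S` = the `S`-matrix. NO coherence axioms are recorded (see the module docstring: they
live with `ModularDatum`). [cite: WalkerWang2011, §4.1.1] -/
structure InputData (q : ℕ) where
  /-- The trivial (vacuum) label. -/
  unit : Fin q
  /-- Fusion multiplicities `N_{ab}^c`. -/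
  N : Fin q → Fin q → Fin q → ℕ
  /-- Quantum dimensions `d_s`. -/
  qdim : Fin q → ℝ
  /-- `F`-symbols, `F a b c d n m = F^{abc}_{d;nm}`. -/
  F : Fin q → Fin q → Fin q → Fin q → Fin q → Fin q → ℂ
  /-- `R`-symbols, `R a b c = R^{ab}_c`. -/
  R : Fin q → Fin q → Fin q → ℂ
  /-- The modular `S`-matrix `S_{ab}`. -/
  S : Matrix (Fin q) (Fin q) ℂ

variable {q : ℕ}

/-- The total quantum dimension squared `D² = Σ_s d_s²`. Walker–Wang (2011) §4.1.2.
[cite: WalkerWang2011, §4.1.2] -/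
def InputData.totalDimSq (C : InputData q) : ℝ := ∑ s, C.qdim s ^ 2

/-- The Walker–Wang loop weights `d_s / D²` of the projector `ω₀ = Σ_s (d_s/D²) s`
(`B_p = Σ_s (d_s/D²) B_p^s`). Walker–Wang (2011) §4.1.2; vKBS §VI.A.
[cite: WalkerWang2011, §4.1.2] -/
def InputData.wwWeight (C : InputData q) (s : Fin q) : ℝ := C.qdim s / C.totalDimSq

/-- Transport of input data given on an arbitrary finite label type `Lab` (e.g. the label type
of a bundled modular datum) to the label set `Fin (card Lab)` along Mathlib's `Fintype.equivFin`.
[folklore] -/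
def InputData.ofLabels {Lab : Type*} [Fintype Lab] (unit : Lab) (N : Lab → Lab → Lab → ℕ)
    (qdim : Lab → ℝ) (F : Lab → Lab → Lab → Lab → Lab → Lab → ℂ) (R : Lab → Lab → Lab → ℂ)
    (S : Matrix Lab Lab ℂ) : InputData (Fintype.card Lab) :=
  let e : Fin (Fintype.card Lab) ≃ Lab := (Fintype.equivFin Lab).symm
  { unit := e.symm unit
    N := fun a b c => N (e a) (e b) (e c)
    qdim := fun a => qdim (e a)
    F := fun a b c d n m => F (e a) (e b) (e c) (e d) (e n) (e m)
    R := fun a b c => R (e a) (e b) (e c)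
    S := S.submatrix e e }

/-! ### The point-split cubic torus -/

/-- The edges of the resolved cubic torus: `(n, slot)` with `slot : Fin 6` — `0, 1, 2` the lattice
edges from `n` to `n + x̂, ŷ, ẑ`, and `3 = I1 = V1V2`, `4 = I3 = V2V3`, `5 = I4 = V2V4` the internal
point-splitting edges at `n` (decorated torus `TorusSite 3 L × κ`, `κ = Fin 6`).
Walker–Wang (2011) §4.1.2 (resolution figure). [cite: WalkerWang2011, §4.1.2] -/
abbrev Edge (L : ℕ) : Type := TorusSite 3 L × Fin 6

/-- A relative edge: an integer offset from the base vertex and a slot. [folklore] -/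
abbrev RelEdge : Type := (Fin 3 → ℤ) × Fin 6

variable (C : InputData q) (L : ℕ)

/-- Placing a relative edge at the base vertex `n` of the torus (offsets reduced mod `L`).
[folklore] -/
def place (n : TorusSite 3 L) (r : RelEdge) : Edge L := (n + fun i => (r.1 i : ZMod L), r.2)

/-- The `ℤ₃` symmetry `x → y → z → x` of the resolution (rotation about `(1,1,1)`): on offsets
`(α, β, γ) ↦ (γ, α, β)`, on slots `x → y → z → x`, `I1 → I3 → I4 → I1` (since `V1 → V3 → V4 → V1`).
Walker–Wang (2011) §4.1.2 ("with a `ℤ₃`-symmetry"). [cite: WalkerWang2011, §4.1.2] -/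
def rotRel (r : RelEdge) : RelEdge :=
  (fun i => r.1 (i - 1), (![1, 2, 0, 4, 5, 3] : Fin 6 → Fin 6) r.2)

/-- The three edges of the trivalent vertex `Vₖ₊₁` at `n`, `k : Fin 4`: `V1 = {+x, -y, I1}`,
`V2 = {I1, I3, I4}`, `V3 = {+y, -z, I3}`, `V4 = {+z, -x, I4}` (relative form).
Walker–Wang (2011) §4.1.2, resolution figure. [cite: WalkerWang2011, §4.1.2] -/
def vertexRel : Fin 4 → Fin 3 → RelEdge :=
  ![![(![0, 0, 0], 0), (![0, -1, 0], 1), (![0, 0, 0], 3)],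
    ![(![0, 0, 0], 3), (![0, 0, 0], 4), (![0, 0, 0], 5)],
    ![(![0, 0, 0], 1), (![0, 0, -1], 2), (![0, 0, 0], 4)],
    ![(![0, 0, 0], 2), (![-1, 0, 0], 0), (![0, 0, 0], 5)]]

/-- The three edges `vertexEdge n k j`, `j : Fin 3`, at the trivalent vertex `Vₖ₊₁` of the unit
cell `n`. Walker–Wang (2011) §4.1.2. [cite: WalkerWang2011, §4.1.2] -/
def vertexEdge (n : TorusSite 3 L) (k : Fin 4) (j : Fin 3) : Edge L := place L n (vertexRel k j)

/-- The ten boundary edges of the `xy`-decagon with rear-left corner `n`, in WW's cyclic order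
`a p q b c r u d v w` (relative form; corners `n`, `n + ŷ`, `n + x̂`, `n + x̂ + ŷ`).
Walker–Wang (2011) §4.1.2, labelled plaquette figure. [cite: WalkerWang2011, §4.1.2] -/
def boundaryRelXY : Fin 10 → RelEdge :=
  ![(![1, 0, 0], 1), (![1, 1, 0], 3), (![1, 1, 0], 5), (![0, 1, 0], 0), (![0, 0, 0], 1),
    (![0, 0, 0], 4), (![0, 0, 0], 3), (![0, 0, 0], 0), (![1, 0, 0], 5), (![1, 0, 0], 4)]

/-- The ten legs `a' p' q' b' c' r' u' d' v' w'` of the `xy`-decagon: entry `i` is the third edge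
at the vertex between boundary edges `i` and `i + 1` (relative form).
Walker–Wang (2011) §4.1.2, labelled plaquette figure. [cite: WalkerWang2011, §4.1.2] -/
def legRelXY : Fin 10 → RelEdge :=
  ![(![1, 1, 0], 0), (![1, 1, 0], 4), (![1, 1, 0], 2), (![0, 1, 0], 3), (![0, 0, -1], 2),
    (![0, 0, 0], 5), (![0, -1, 0], 1), (![1, 0, 0], 2), (![1, 0, 0], 3), (![1, 0, -1], 2)]

/-- Boundary edge `i : Fin 10` of the decagon of orientation `μ` (`0 = xy`, `1 = yz`, `2 = zx`, the
latter two by the `ℤ₃` rotation `rotRel`) based at `n`. Walker–Wang (2011) §4.1.2.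
[cite: WalkerWang2011, §4.1.2] -/
def boundaryEdge (μ : Fin 3) (n : TorusSite 3 L) (i : Fin 10) : Edge L :=
  place L n (rotRel^[μ.val] (boundaryRelXY i))

/-- Leg `i : Fin 10` (the edge adjacent to the decagon at its `i`-th vertex) of the plaquette of
orientation `μ` based at `n`. Walker–Wang (2011) §4.1.2. [cite: WalkerWang2011, §4.1.2] -/
def legEdge (μ : Fin 3) (n : TorusSite 3 L) (i : Fin 10) : Edge L :=
  place L n (rotRel^[μ.val] (legRelXY i))

/-- The `ℤ₃` rotation has order three. Walker–Wang (2011) §4.1.2. [folklore] -/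
theorem rotRel_rotRel_rotRel (r : RelEdge) : rotRel (rotRel (rotRel r)) = r := by
  obtain ⟨v, k⟩ := r
  simp only [rotRel, Prod.mk.injEq]
  refine ⟨?_, ?_⟩
  · funext i
    fin_cases i <;> rfl
  · fin_cases k <;> rfl

/-- Translating a relative edge by a lattice vector. [folklore] -/
def shiftRel (m : Fin 3 → ℤ) (r : RelEdge) : RelEdge := (m + r.1, r.2)

/-- Consistency of the decagon tables with the resolution: for every `i`, the edges
`boundaryRelXY i`, `boundaryRelXY (i + 1)` and `legRelXY i` are exactly the three edges of a
trivalent vertex `Vₖ` of some unit cell (namely `k = 1,2,4,1,3,2,1,4,2,3` at the corners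
`x̂+ŷ, x̂+ŷ, x̂+ŷ, ŷ, 0, 0, 0, x̂, x̂, x̂`), checked by `decide`. Walker–Wang (2011) §4.1.2,
labelled plaquette figure. [cite: WalkerWang2011, §4.1.2] -/
theorem decagonVertex_eq_vertexRel (i : Fin 10) :
    ({boundaryRelXY i, boundaryRelXY (i + 1), legRelXY i} : Finset RelEdge) =
      univ.image fun j => shiftRel ((![![1, 1, 0], ![1, 1, 0], ![1, 1, 0], ![0, 1, 0], ![0, 0, 0],
        ![0, 0, 0], ![0, 0, 0], ![1, 0, 0], ![1, 0, 0], ![1, 0, 0]] : Fin 10 → Fin 3 → ℤ) i)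
        (vertexRel ((![0, 1, 3, 0, 2, 1, 0, 3, 1, 2] : Fin 10 → Fin 4) i) j) := by
  revert i
  decide

variable [NeZero L]

/-- The region of a vertex term: the three edges at `Vₖ₊₁(n)`. Walker–Wang (2011) §4.1.2.
[cite: WalkerWang2011, §4.1.2] -/
def vertexRegion (n : TorusSite 3 L) (k : Fin 4) : Finset (Edge L) := univ.image (vertexEdge L n k)

/-- The region of a plaquette term: its `10` boundary edges and `10` legs (vKBS §III: `∂p` and
`s(p)`). [cite: VonkeyserlingkBurnellSimon2013, §III] -/
def plaquetteRegion (μ : Fin 3) (n : TorusSite 3 L) : Finset (Edge L) :=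
  univ.image (boundaryEdge L μ n) ∪ univ.image (legEdge L μ n)

/-! ### Vertex projectors and the string-net subspace -/

/-- The configuration `σ` is admissible at the vertex `Vₖ₊₁(n)`: its three labels obey the fusion
rules, `N a b c ≠ 0`. Walker–Wang (2011) §4.1.2 (`A_v`). [cite: WalkerWang2011, §4.1.2] -/
def IsAdmissibleAt (σ : TensorIndex (Edge L) q) (n : TorusSite 3 L) (k : Fin 4) : Prop :=
  C.N (σ (vertexEdge L n k 0)) (σ (vertexEdge L n k 1)) (σ (vertexEdge L n k 2)) ≠ 0

/-- Admissibility at a vertex is decidable (a test `N a b c ≠ 0`). [folklore] -/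
instance instDecidableIsAdmissibleAt (σ : TensorIndex (Edge L) q) (n : TorusSite 3 L) (k : Fin 4) :
    Decidable (IsAdmissibleAt C L σ n k) := inferInstanceAs (Decidable (_ ≠ _))

/-- The vertex projector `A_v`, `v = Vₖ₊₁(n)`: `A_v |σ⟩ = |σ⟩` if the three labels around `v` obey
the fusion rules, else `0`. Walker–Wang (2011) §4.1.2. [cite: WalkerWang2011, §4.1.2] -/
def vertexProj (n : TorusSite 3 L) (k : Fin 4) : Op (Edge L) q :=
  diagonal fun σ => if IsAdmissibleAt C L σ n k then 1 else 0

/-- The vertex terms as an interaction (energetic form): `Φ (s(v)) = 1 - A_v` on the region of each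
trivalent vertex, `0` elsewhere (WW's `-J₁ Σ_v A_v` up to the constant `J₁ · 4L³`).
Walker–Wang (2011) §4.1.2; BvKS §III.A eq. (HWW) (`-M Σ_V Q_V`). [cite: WalkerWang2011, §4.1.2] -/
def vertexTerms : Interaction (Edge L) q := fun X =>
  ∑ n : TorusSite 3 L, ∑ k : Fin 4, if X = vertexRegion L n k then 1 - vertexProj C L n k else 0

/-- The string-net subspace (hard vertex constraint): the common kernel `⋂_v ker (1 - A_v)`, i.e.
the span of the label configurations admissible at every trivalent vertex.
Walker–Wang (2011) §4.2; BvKS §III.A (`M → ∞`). [cite: WalkerWang2011, §4.2] -/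
def stringNetSubspace : Submodule ℂ (TensorIndex (Edge L) q → ℂ) :=
  ⨅ n : TorusSite 3 L, ⨅ k : Fin 4, LinearMap.ker (toLin' (1 - vertexProj C L n k))

/-- The diagonal projection `∏_v A_v` onto the string-net subspace (`1` on everywhere-admissible
configurations, `0` otherwise). BvKS §III.A. [cite: BurnellVonkeyserlingkSimon2013, §III.A] -/
def stringNetProj : Op (Edge L) q :=
  diagonal fun σ => if ∀ n k, IsAdmissibleAt C L σ n k then 1 else 0

/-! ### Plaquette operators -/

/-- **The Walker–Wang plaquette coefficient** (WW §4.1.2, the display following "we claim"): for the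
loop label `s`, new boundary labels `new = (a'', p'', …, w'')`, old boundary labels
`old = (a, p, …, w)` (cyclic order, `Fin 10`) and leg labels `leg = (a', p', …, w')`,
`∏ᵢ F^{newᵢ s oldᵢ₊₁}_{legᵢ; oldᵢ newᵢ₊₁} · R^{q'b}_q · conj R^{q'b''}_{q''} · conj R^{c'r}_c ·
R^{c'r''}_{c''}`
with `q' = leg 2`, `q⁽''⁾ = old/new 2`, `b⁽''⁾ = old/new 3`, `c' = leg 4`, `c⁽''⁾ = old/new 4`,
`r⁽''⁾ = old/new 5`. [cite: WalkerWang2011, §4.1.2] -/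
def plaquetteCoeff (s : Fin q) (new old leg : Fin 10 → Fin q) : ℂ :=
  (∏ i : Fin 10, C.F (new i) s (old (i + 1)) (leg i) (old i) (new (i + 1))) *
    (C.R (leg 2) (old 3) (old 2) * star (C.R (leg 2) (new 3) (new 2)) *
      (star (C.R (leg 4) (old 5) (old 4)) * C.R (leg 4) (new 5) (new 4)))

/-- **The plaquette operator `B_p^s`** inserting an `s`-labelled loop around the decagon
`p = (μ, n)`
and fusing it into the boundary with the fixed `(1,1,1)` projection: `⟨τ| B_p^s |σ⟩ =
plaquetteCoeff s (τ ∘ ∂p) (σ ∘ ∂p) (σ ∘ legs)` if `τ = σ` off the ten boundary edges, else `0`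
(row index `τ` = new labels, column index `σ` = old labels).
Walker–Wang (2011) §4.1.2; vKBS §VI.A (`Ŵ^i_V(∂p)`); Levin–Wen (2005) (2D analogue).
[cite: WalkerWang2011, §4.1.2] -/
def plaquetteOp (μ : Fin 3) (n : TorusSite 3 L) (s : Fin q) : Op (Edge L) q :=
  of fun τ σ => if ∀ e, e ∉ univ.image (boundaryEdge L μ n) → τ e = σ e then
    plaquetteCoeff C s (fun i => τ (boundaryEdge L μ n i)) (fun i => σ (boundaryEdge L μ n i))
      (fun i => σ (legEdge L μ n i)) else 0

/-- The magnetic (plaquette) interaction with loop weights `wM`: `Φ (region p) = -Σ_s wM s • B_p^s`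
on each of the `3L³` plaquette regions, `0` elsewhere (WW: `wM = d/D²`, `-J₂ Σ_p B_p`; BvKS eq.
(HWW): `λ Σ_P (1 - B_P)` up to a constant). [cite: WalkerWang2011, §4.1.2] -/
def magnetic (wM : Fin q → ℝ) : Interaction (Edge L) q := fun X =>
  ∑ μ : Fin 3, ∑ n : TorusSite 3 L,
    if X = plaquetteRegion L μ n then -∑ s, (wM s : ℂ) • plaquetteOp C L μ n s else 0

/-! ### The Verlinde (electric) field -/

/-- The eigenvalue `Σ_s wE s · S_{s a} / S_{0 a}` of the Verlinde field on an edge of label `a`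
(BvKS §V eq. (hSU2) is `wE = δ_m`: `S_{m a}/S_{0 a}`). **Junk value**: Lean's `x / 0 = 0` if
`S_{0 a} = 0` (impossible for modular data, `S_{0a} = d_a/D > 0`).
[cite: BurnellVonkeyserlingkSimon2013, §V eq. (hSU2)] -/
def verlindeEigenvalue (wE : Fin q → ℝ) (a : Fin q) : ℂ :=
  ∑ s, (wE s : ℂ) * C.S s a / C.S C.unit a

/-- The Verlinde field `h_e` on the edge `e`: the single-site diagonal matrix
`diag (verlindeEigenvalue wE)` placed at `e`. BvKS §III.A eq. (HWW) (`-Γ Σ_e h_e`), §V eq. (hSU2).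
[cite: BurnellVonkeyserlingkSimon2013, §V eq. (hSU2)] -/
def electricOp (wE : Fin q → ℝ) (e : Edge L) : Op (Edge L) q :=
  onSite e (diagonal (verlindeEigenvalue C wE))

/-- The electric interaction `Φ {e} = -h_e` (`0` on non-singletons). BvKS §III.A eq. (HWW).
[cite: BurnellVonkeyserlingkSimon2013, §III.A eq. (HWW)] -/
def electric (wE : Fin q → ℝ) : Interaction (Edge L) q := fun X =>
  ∑ e : Edge L, if X = {e} then -electricOp C L wE e else 0

/-! ### The Hamiltonian and the transfer matrix -/

/-- **The Walker–Wang interaction with Verlinde field**: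
`J • vertexTerms + lamB • magnetic wM + lamE • electric wE`, i.e. the local Hamiltonian
`H = J Σ_v (1 - A_v) - lamB Σ_p Σ_s wM(s) B_p^s - lamE Σ_e h_e` (`J = 0`: no vertex penalty, to be
compressed to `stringNetSubspace`). WW §4.1.2 (`lamE = 0`, `wM = d/D²`); BvKS §III.A eq. (HWW), §V.
[cite: BurnellVonkeyserlingkSimon2013, §III.A eq. (HWW)] -/
def interaction (J : ℝ) (wM wE : Fin q → ℝ) (lamB lamE : ℝ) : Interaction (Edge L) q :=
  (J : ℂ) • vertexTerms C L + (lamB : ℂ) • magnetic C L wM + (lamE : ℂ) • electric C L wE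

end WalkerWang

open WalkerWang

variable {q : ℕ} (C : InputData q) (L : ℕ) [NeZero L]

/-- **The Walker–Wang Hamiltonian** of the datum `C` on the point-split cubic torus `(ℤ/Lℤ)³` with
vertex coupling `J`, magnetic weights/coupling `wM, lamB` and Verlinde weights/coupling `wE, lamE`:
`H = Σ_X (interaction C L J wM wE lamB lamE) X = J Σ_v (1 - A_v) - lamB Σ_p Σ_s wM(s) B_p^s
- lamE Σ_e h_e`. Walker–Wang (2011) §4.1.2; BvKS §III.A eq. (HWW). [cite: WalkerWang2011, §4.1.2] -/
def walkerWangHamiltonian (J : ℝ) (wM wE : Fin q → ℝ) (lamB lamE : ℝ) : Op (Edge L) q :=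
  localHamiltonian (interaction C L J wM wE lamB lamE) univ

namespace WalkerWang

/-- The "magnetic" Hamiltonian `H_M = J Σ_v (1 - A_v) - lamB Σ_p Σ_s wM(s) B_p^s` (vertex and
plaquette part; the solvable Walker–Wang Hamiltonian at `wM = d/D²`). Walker–Wang (2011) §4.1.2.
[cite: WalkerWang2011, §4.1.2] -/
def magneticHamiltonian (J : ℝ) (wM : Fin q → ℝ) (lamB : ℝ) : Op (Edge L) q :=
  localHamiltonian ((J : ℂ) • vertexTerms C L + (lamB : ℂ) • magnetic C L wM) univ

/-- The "electric" Hamiltonian `H_E = -lamE Σ_e h_e` (Verlinde-field part). BvKS §III.A eq. (HWW).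
[cite: BurnellVonkeyserlingkSimon2013, §III.A eq. (HWW)] -/
def electricHamiltonian (wE : Fin q → ℝ) (lamE : ℝ) : Op (Edge L) q :=
  localHamiltonian ((lamE : ℂ) • electric C L wE) univ

end WalkerWang

/-- `H = H_M + H_E` (the local Hamiltonian is additive in the interaction). [folklore] -/
theorem walkerWangHamiltonian_eq_add (J : ℝ) (wM wE : Fin q → ℝ) (lamB lamE : ℝ) :
    walkerWangHamiltonian C L J wM wE lamB lamE =
      magneticHamiltonian C L J wM lamB + electricHamiltonian C L wE lamE :=
  localHamiltonian_add _ _ _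

/-- The Euclidean-time transfer matrix `T = e^{-H_M/2} e^{-H_E} e^{-H_M/2}` of the model
(`Matrix.gibbsWeight β H = e^{-βH}`; symmetric splitting of `H = H_M + H_E`, as for Wilson's
lattice-gauge transfer matrix). [folklore] -/
def walkerWangTransfer (J : ℝ) (wM wE : Fin q → ℝ) (lamB lamE : ℝ) : Op (Edge L) q :=
  (magneticHamiltonian C L J wM lamB).gibbsWeight (1 / 2) *
    (electricHamiltonian C L wE lamE).gibbsWeight 1 *
      (magneticHamiltonian C L J wM lamB).gibbsWeight (1 / 2)

/-! ### API -/

namespace WalkerWang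

variable {L C}

/-- The interaction splits as vertex + magnetic + electric parts (definitional). [folklore] -/
theorem interaction_apply (J : ℝ) (wM wE : Fin q → ℝ) (lamB lamE : ℝ) (X : Finset (Edge L)) :
    interaction C L J wM wE lamB lamE X =
      (J : ℂ) • vertexTerms C L X + (lamB : ℂ) • magnetic C L wM X +
        (lamE : ℂ) • electric C L wE X :=
  rfl

/-- The Walker–Wang Hamiltonian is the local Hamiltonian of `interaction` over the whole torus
(definitional). [folklore] -/
theorem _root_.Literature.MathematicalPhysics.QuantumLattice.walkerWangHamiltonian_eq
    (J : ℝ) (wM wE : Fin q → ℝ) (lamB lamE : ℝ) :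
    walkerWangHamiltonian C L J wM wE lamB lamE =
      localHamiltonian (interaction C L J wM wE lamB lamE) univ :=
  rfl

/-- A single-site diagonal matrix placed at `x` is diagonal in the product basis:
`onSite x (diag d) = diag (σ ↦ d (σ x))`. Tasaki (2020) §2.2. [folklore] -/
theorem onSite_diagonal {Λ : Type*} [Fintype Λ] [DecidableEq Λ] (x : Λ) (d : Fin q → ℂ) :
    onSite x (diagonal d) = diagonal fun σ : TensorIndex Λ q => d (σ x) := by
  ext σ τ
  simp only [onSite_apply, diagonal_apply]
  by_cases hστ : σ = τ
  · subst hστ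
    simp
  · rw [if_neg hστ]
    split_ifs with h1 h2
    · exact absurd (funext fun y => if hy : y = x then hy ▸ h2 else h1 y hy) hστ
    · rfl
    · rfl

/-- A diagonal matrix on the region `X` tensored with the identity is diagonal:
`localOp X (diag g) = diag (σ ↦ g (σ|_X))`. Bratteli–Robinson II §6.2.1. [folklore] -/
theorem localOp_diagonal {Λ : Type*} [Fintype Λ] [DecidableEq Λ] (X : Finset Λ)
    (g : (X → Fin q) → ℂ) :
    localOp X (diagonal g) = diagonal fun σ : TensorIndex Λ q => g fun x => σ x := by
  ext σ τ
  simp only [localOp_apply, diagonal_apply]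
  by_cases hστ : σ = τ
  · subst hστ
    simp
  · rw [if_neg hστ]
    split_ifs with h1 h2
    · refine absurd (funext fun y => ?_) hστ
      by_cases hy : y ∈ X
      · exact congrFun h2 ⟨y, hy⟩
      · exact h1 y hy
    · rfl
    · rfl

/-- `h_e` is diagonal in the label basis with eigenvalue `verlindeEigenvalue wE (σ e)` on `|σ⟩`.
BvKS §V eq. (hSU2). [cite: BurnellVonkeyserlingkSimon2013, §V eq. (hSU2)] -/
theorem electricOp_eq_diagonal (wE : Fin q → ℝ) (e : Edge L) :
    electricOp C L wE e = diagonal fun σ => verlindeEigenvalue C wE (σ e) :=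
  onSite_diagonal e _

/-- The Verlinde fields commute among themselves, `[h_e, h_e'] = 0`. BvKS §III.A (display after
eq. (HWW)). [cite: BurnellVonkeyserlingkSimon2013, §III.A] -/
theorem electricOp_commute (wE : Fin q → ℝ) (e e' : Edge L) :
    Commute (electricOp C L wE e) (electricOp C L wE e') := by
  rw [electricOp_eq_diagonal, electricOp_eq_diagonal, Commute, SemiconjBy, diagonal_mul_diagonal,
    diagonal_mul_diagonal]
  simp_rw [mul_comm]

/-- The Verlinde field commutes with the vertex projectors, `[h_e, A_v] = 0` (both are diagonal in
the label basis). BvKS §III.A (`[h_e, Q_V] = 0`). [cite: BurnellVonkeyserlingkSimon2013, §III.A] -/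
theorem vertexProj_commute_electricOp (n : TorusSite 3 L) (k : Fin 4) (wE : Fin q → ℝ)
    (e : Edge L) :
    Commute (vertexProj C L n k) (electricOp C L wE e) := by
  rw [electricOp_eq_diagonal, vertexProj, Commute, SemiconjBy, diagonal_mul_diagonal,
    diagonal_mul_diagonal]
  simp_rw [mul_comm]

/-- The vertex projectors commute, `[A_v, A_v'] = 0`. BvKS §III.A (`[Q_V, Q_V'] = 0`).
[cite: BurnellVonkeyserlingkSimon2013, §III.A] -/
theorem vertexProj_commute (n n' : TorusSite 3 L) (k k' : Fin 4) :
    Commute (vertexProj C L n k) (vertexProj C L n' k') := by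
  rw [vertexProj, vertexProj, Commute, SemiconjBy, diagonal_mul_diagonal, diagonal_mul_diagonal]
  simp_rw [mul_comm]

/-- `A_v² = A_v`. Walker–Wang (2011) §4.1.2. [folklore] -/
theorem vertexProj_mul_self (n : TorusSite 3 L) (k : Fin 4) :
    vertexProj C L n k * vertexProj C L n k = vertexProj C L n k := by
  rw [vertexProj, diagonal_mul_diagonal]
  congr 1
  funext σ
  split_ifs <;> simp

/-- `A_v` is Hermitian. Walker–Wang (2011) §4.1.2. [folklore] -/
theorem vertexProj_isHermitian (n : TorusSite 3 L) (k : Fin 4) :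
    (vertexProj C L n k).IsHermitian := by
  rw [IsHermitian, vertexProj, diagonal_conjTranspose]
  congr 1
  funext σ
  rw [Pi.star_apply]
  split_ifs <;> simp

/-- `(∏_v A_v)² = ∏_v A_v`: `stringNetProj` is idempotent. BvKS §III.A. [folklore] -/
theorem stringNetProj_mul_self : stringNetProj C L * stringNetProj C L = stringNetProj C L := by
  rw [stringNetProj, diagonal_mul_diagonal]
  congr 1
  funext σ
  split_ifs <;> simp

/-- `stringNetProj` is Hermitian. BvKS §III.A. [folklore] -/
theorem stringNetProj_isHermitian : (stringNetProj C L).IsHermitian := by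
  rw [IsHermitian, stringNetProj, diagonal_conjTranspose]
  congr 1
  funext σ
  rw [Pi.star_apply]
  split_ifs <;> simp

/-- The Verlinde field preserves the string-net subspace: `[h_e, ∏_v A_v] = 0`. BvKS §III.A.
[cite: BurnellVonkeyserlingkSimon2013, §III.A] -/
theorem stringNetProj_commute_electricOp (wE : Fin q → ℝ) (e : Edge L) :
    Commute (stringNetProj C L) (electricOp C L wE e) := by
  rw [electricOp_eq_diagonal, stringNetProj, Commute, SemiconjBy, diagonal_mul_diagonal,
    diagonal_mul_diagonal]
  simp_rw [mul_comm]

/-- The vertex projectors preserve the string-net subspace: `[A_v, ∏_w A_w] = 0`. BvKS §III.A.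
[folklore] -/
theorem stringNetProj_commute_vertexProj (n : TorusSite 3 L) (k : Fin 4) :
    Commute (stringNetProj C L) (vertexProj C L n k) := by
  rw [vertexProj, stringNetProj, Commute, SemiconjBy, diagonal_mul_diagonal, diagonal_mul_diagonal]
  simp_rw [mul_comm]

/-- `(∏_v A_v) ψ` kills the amplitudes of non-admissible configurations. BvKS §III.A. [folklore] -/
theorem stringNetProj_mulVec_apply (ψ : TensorIndex (Edge L) q → ℂ) (σ : TensorIndex (Edge L) q) :
    (stringNetProj C L *ᵥ ψ) σ = if ∀ n k, IsAdmissibleAt C L σ n k then ψ σ else 0 := by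
  rw [stringNetProj, mulVec_diagonal]
  split_ifs <;> simp

/-- Membership in the string-net subspace: `ψ` is supported on everywhere-admissible
configurations. Walker–Wang (2011) §4.2. [cite: WalkerWang2011, §4.2] -/
theorem mem_stringNetSubspace_iff (ψ : TensorIndex (Edge L) q → ℂ) :
    ψ ∈ stringNetSubspace C L ↔ ∀ σ, ψ σ ≠ 0 → ∀ n k, IsAdmissibleAt C L σ n k := by
  have key : ∀ n k, (toLin' (1 - vertexProj C L n k)) ψ = 0 ↔
      ∀ σ, ψ σ ≠ 0 → IsAdmissibleAt C L σ n k := by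
    intro n k
    rw [toLin'_apply, Matrix.sub_mulVec, one_mulVec, vertexProj, funext_iff]
    refine forall_congr' fun σ => ?_
    rw [Pi.sub_apply, mulVec_diagonal, Pi.zero_apply]
    by_cases h : IsAdmissibleAt C L σ n k <;> simp [h]
  simp only [stringNetSubspace, Submodule.mem_iInf, LinearMap.mem_ker, key]
  exact ⟨fun h σ hσ n k => h n k σ hσ, fun h n k σ hσ => h σ hσ n k⟩

/-- The range of `∏_v A_v` is the string-net subspace (hard constraint = image of the diagonal
projection). Walker–Wang (2011) §4.2; BvKS §III.A. [folklore] -/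
theorem range_stringNetProj :
    LinearMap.range (toLin' (stringNetProj C L)) = stringNetSubspace C L := by
  ext ψ
  rw [LinearMap.mem_range, mem_stringNetSubspace_iff]
  constructor
  · rintro ⟨φ, rfl⟩ σ hσ n k
    rw [toLin'_apply, stringNetProj_mulVec_apply] at hσ
    by_contra hn
    exact hσ (if_neg fun h => hn (h n k))
  · intro h
    refine ⟨ψ, funext fun σ => ?_⟩
    rw [toLin'_apply, stringNetProj_mulVec_apply]
    split_ifs with hσ
    · rfl
    · by_contra hne
      exact hσ (h σ (Ne.symm hne))

/-- `h_e` is Hermitian whenever its eigenvalues are real (e.g. `SU(2)_k`, where `S` is real).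
BvKS §V eq. (hSU2). [cite: BurnellVonkeyserlingkSimon2013, §V eq. (hSU2)] -/
theorem electricOp_isHermitian {wE : Fin q → ℝ} (h : ∀ a, star (verlindeEigenvalue C wE a) =
    verlindeEigenvalue C wE a) (e : Edge L) : (electricOp C L wE e).IsHermitian := by
  rw [IsHermitian, electricOp_eq_diagonal, diagonal_conjTranspose]
  congr 1
  funext σ
  rw [Pi.star_apply]
  exact h (σ e)

/-! ### Supports -/

/-- `A_v ∈ 𝔄_{s(v)}`: the vertex projector is supported on the three edges of its vertex.
Walker–Wang (2011) §4.1.2. [folklore] -/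
theorem isSupportedOn_vertexProj (n : TorusSite 3 L) (k : Fin 4) :
    IsSupportedOn (vertexProj C L n k) (vertexRegion L n k) := by
  have hm : ∀ j, vertexEdge L n k j ∈ vertexRegion L n k := fun j => mem_image_of_mem _ (mem_univ j)
  refine ⟨diagonal fun σ => if C.N (σ ⟨_, hm 0⟩) (σ ⟨_, hm 1⟩) (σ ⟨_, hm 2⟩) ≠ 0 then 1 else 0, ?_⟩
  rw [localOp_diagonal]
  rfl

/-- `h_e ∈ 𝔄_{{e}}`. BvKS §III.A. [folklore] -/
theorem isSupportedOn_electricOp (wE : Fin q → ℝ) (e : Edge L) :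
    IsSupportedOn (electricOp C L wE e) {e} :=
  isSupportedOn_onSite_holds e _

/-- `B_p^s ∈ 𝔄_{∂p ∪ s(p)}`: the plaquette operator is supported on the boundary edges and legs of
its plaquette (it is diagonal in the legs and the identity off the region). vKBS §III.
[cite: VonkeyserlingkBurnellSimon2013, §III] -/
theorem isSupportedOn_plaquetteOp (μ : Fin 3) (n : TorusSite 3 L) (s : Fin q) :
    IsSupportedOn (plaquetteOp C L μ n s) (plaquetteRegion L μ n) := by
  classical
  have hb : ∀ i, boundaryEdge L μ n i ∈ plaquetteRegion L μ n := fun i =>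
    mem_union_left _ (mem_image_of_mem _ (mem_univ i))
  have hl : ∀ i, legEdge L μ n i ∈ plaquetteRegion L μ n := fun i =>
    mem_union_right _ (mem_image_of_mem _ (mem_univ i))
  refine ⟨of fun τ σ => if ∀ x : ↥(plaquetteRegion L μ n),
      (x : Edge L) ∉ univ.image (boundaryEdge L μ n) → τ x = σ x then
    plaquetteCoeff C s (fun i => τ ⟨_, hb i⟩) (fun i => σ ⟨_, hb i⟩) (fun i => σ ⟨_, hl i⟩)
    else 0, ?_⟩
  ext τ σ
  rw [localOp_apply, of_apply, plaquetteOp, of_apply]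
  by_cases h : ∀ e, e ∉ univ.image (boundaryEdge L μ n) → τ e = σ e
  · have h1 : ∀ y, y ∉ plaquetteRegion L μ n → τ y = σ y := fun y hy =>
      h y fun hyB => hy (mem_union_left _ hyB)
    have h2 : ∀ x : ↥(plaquetteRegion L μ n),
        (x : Edge L) ∉ univ.image (boundaryEdge L μ n) → τ x = σ x := fun x hx => h x hx
    rw [if_pos h1, if_pos h2, if_pos h]
  · rw [if_neg h]
    by_cases h1 : ∀ y, y ∉ plaquetteRegion L μ n → τ y = σ y
    · rw [if_pos h1, if_neg]
      intro h2
      exact h fun e he => if hr : e ∈ plaquetteRegion L μ n then h2 ⟨e, hr⟩ he else h1 e hr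
    · rw [if_neg h1]

end WalkerWang

end Literature.MathematicalPhysics.QuantumLattice
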